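import Summits.QuantumFields.YangMills.Theorems.BalabanUVNodesN21TopLetteredReading13CoPH

/-!
# N21 (NE7c) · THE TOP-LETTERED SPINE READING — N19′'s CORE AT IT IS A DEFINITE OBJECT: `A − shA` (run A's top-lettered class weight minus its top-lettered shell part)
# IS the fibre sum of the top-lettered terms with the FRONT FACTOR LOWERED to `θ⋆(1 − ρ_K)` (the last (3.2) weight kept at the selected letter `θ⋆`) — the object the
# K3 skeleton's `KeyedCoreEdgeHolderD4` reads at `crTop₁₃VAt`, spelled out (g9 FILE 2 §3b's «core of record» on the selected-cut road)

R134 seat `pub-ymgap-dag-n21-d` (g10), node N21 = NE7c, strategy s2; lane K3⁷ `SpineGivenEndpointR13SepCoPH` (stmt-QuantumFields-20544, `--supports … --as helper`;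
COUNT-NEUTRAL).  Imports R2 `…N21TopLetteredReading13CoPH` (hence R1 v1.1's `topLoweredAtLevel ∕ topCoreA₁₃ ∕ topCoreB₁₃` and T3 §20a `topClassWeight_sub_topBand_eq_lowered`).

WHAT THIS FILE PROVES (theorems only; 0 `def`, 0 `sorry`).
* §26 `topTermAtLevel_sub_topBandAtLevel_eq_lowered` (NODE 00's generality, at the run's top `j = p.K`, `θ′ ≤ θ`; `cases` on the level + T3 §20a) · `cutGrid_succ_le`
  (`0 ≤ ε`, `0 ≤ ρ ≤ 1 ⇒ θ_{i+1} ≤ θ_i`) · ★★ `topWeightA₁₃_sub_topShellA₁₃` ∕ ★★ `topWeightB₁₃_sub_topShellB₁₃` — on the live-selector line, under (H-ζ), `0 ≤ ρ_K ≤ 1` and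
  `0 ≤ ε_top`: `topWeightX₁₃ − topShellX₁₃ = topCoreX₁₃` key by key (X = A, B) · ★★ `crTop₁₃VAt_core_eq` — the same for the reading's fields `(cr…).A − (cr…).shA`, `B − shB`.
* §27 ★★ `keyedShellWeight_shape_crTop₁₃V_of_rows` — the K3 skeleton's `KeyedShellWeight` conjunct AT `crTop₁₃V N jcut ρ n`, per tuple with its rows (`hsel` at a tuple-read
  `E`, (H-ζ), `ρ_K ≤ 1`, `Σ 1∕(n_K+1) < ∞`): the pin a `PinnedAtLive` naming this reading would use; (M1)-FREE.

HONEST FRAMING (binding).  Bookkeeping; NO estimate; N19′'s SANDWICH of these cores (the `NE7.Core` face) is NOT claimed — this file only names its object; the sign rows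
`0 ≤ ρ_K`, `0 ≤ ε_top` are the meaningful regime (ref-J READ-213's vacuity note); NE7c NOT PRINTED ∕ NOT proved at print's thresholds; N21 NOT discharged; K3⁷ NOT claimed;
counts UNMOVED (typed 28∕28 · discharged 5∕27); never a count claim.  No `instance`, no `notation`, no `def`.  One finite four-torus programme at fixed `ε` — NOT ℝ⁴, NOT
OS, NOT a mass gap, NOT the Clay problem.
-/

noncomputable section

open scoped BigOperators
open Finset MeasureTheory

namespace Summit.QuantumFields.YangMills.Theorems.N21ShellSplitOfRecord13CoPH

open Literature.MathematicalPhysics.QuantumFieldTheory.Balaban1983to89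
open Literature.MathematicalPhysics.QuantumFieldTheory.Balaban1983to89.T4Continuum
open Literature.MathematicalPhysics.QuantumFieldTheory.Balaban1983to89.Node00
open T4IndicatorShell (ShellWeightBound)
open YMDAG.UVSplit (keyA₁₃ keyB₁₃ runA₁₃ runB₁₃ histA₁₃ histB₁₃ histA₁₃_zero histB₁₃_zero classSet₁₃ badClass₁₃)
open Summit.QuantumFields.YangMills.Theorems.N21StepWeightsPositivity (zetaOfRecord_nonneg)

/-! ## §26 The core of the top-lettered reading -/

section CoreLevel

variable (F : T4Family) (N : ℕ) [NeZero N] (ϑ : Stage9Params F N) (D : FiniteEpsData F (SU N)) (g₀ : ℕ → ℝ) (os : List (ULoop F))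
  (p : B12.RunParams) (g : ℕ → ℝ)

/-- **TERM MINUS BAND = THE LOWERED TERM, AT EVERY TOP LEVEL** (`j = p.K`, `θ′ ≤ θ`; level `0`: no band; level `k+1`: T3 §20a).  Displayed: (H-ζ), `Σ|ζ| ≤ 1`, F3's (e1)
below the top. [bookkeeping] -/
theorem topTermAtLevel_sub_topBandAtLevel_eq_lowered (hζm : ZetaMeasurable F N ϑ.ζ) (hζ1 : IsZetaAbsLeOne F N ϑ.ν ϑ.τ9.M ϑ.ζ) {θ θ' : ℝ} (hθ : θ' ≤ θ) (t : ℝ)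
    (hint : ∀ k, k < p.K → ∀ s : SeqOfRecord F ϑ.ν ϑ.τ9.M g p.K k,
      Integrable (fun U => chiSeqOfRecord F N ϑ.ν ϑ.τ9.M g p.K k s U * dressedSlotsOfDatum₉ F N ϑ D g₀ os t p g k s U) (fieldMeasure (F.P p.K) k (SU N))) :
    ∀ (j : ℕ), j = p.K → ∀ s : SeqOfRecord F ϑ.ν ϑ.τ9.M g p.K j,
      topTermAtLevel F N ϑ D g₀ os p g θ t j s - topBandAtLevel F N ϑ D g₀ os p g θ θ' t j s = topLoweredAtLevel F N ϑ D g₀ os p g θ θ' t j s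
  | 0, _, s => by simp only [topTermAtLevel_zero, topBandAtLevel_zero, topLoweredAtLevel_zero, sub_zero]
  | k + 1, hk, s' => by
    simp only [topTermAtLevel_succ, topBandAtLevel_succ, topLoweredAtLevel_succ]
    exact topClassWeight_sub_topBand_eq_lowered F N ϑ D g₀ os p g k (by omega) hζm hζ1 hθ t (hint k (by omega)) s'

variable {F N ϑ D g₀ os p g} in
/-- one step down the grid does not go up, in the meaningful regime `0 ≤ ε`, `0 ≤ ρ ≤ 1`: `θ_{i+1} = θ_i(1 − ρ) ≤ θ_i`. [bookkeeping] -/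
theorem cutGrid_succ_le (k : ℕ) (hε : 0 ≤ epsOfRecord ϑ.ν g k) {ρ : ℝ} (hρ0 : 0 ≤ ρ) (hρ1 : ρ ≤ 1) (i : ℕ) :
    cutGrid ϑ.ν g k ρ (i + 1) ≤ cutGrid ϑ.ν g k ρ i := by
  unfold cutGrid
  rw [pow_succ, ← mul_assoc]
  exact mul_le_of_le_one_right (mul_nonneg hε (pow_nonneg (by linarith) i)) (by linarith)

end CoreLevel

section CoreReading

variable {F : T4Family} {N : ℕ} [NeZero N]

/-- ★★ **RUN A: TOP-LETTERED CLASS WEIGHT MINUS TOP-LETTERED SHELL PART = THE TOP-LETTERED CORE**, key by key, on the live-selector line (rows `hsel`, (H-ζ)), in the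
meaningful regime `0 ≤ ρ_K ≤ 1`, `0 ≤ ε_{K₀+K}`: `topWeightA₁₃ … K t x − topShellA₁₃ … K t x = topCoreA₁₃ … K t x`. [bookkeeping] -/
theorem topWeightA₁₃_sub_topShellA₁₃ (K₀ : ℕ) (θ : Stage13HParams F N) (hP : θ.Provisos₁₃CoPH F N) (g₀ : ℕ → ℝ) (os : List (ULoop F)) (E : B12.RunParams → ℝ)
    (hsel : θ.ppSel = ppSelLiveOfRecord F N θ.ν θ.τ9 E (wOfRecord₉ F N θ.toStage9Params)) (hζm : ZetaMeasurable F N θ.ζ) {ρ : ℕ → ℝ} (n : ℕ → ℕ) (K : ℕ)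
    (hρ0 : 0 ≤ ρ K) (hρ1 : ρ K ≤ 1) (hε : 0 ≤ epsOfRecord θ.ν (histA₁₃ θ K₀ g₀ K) (K₀ + K)) (t : ℝ) (x : Σ K, SiteSeqKey F (K₀ + K)) :
    topWeightA₁₃ θ hP K₀ g₀ os ρ n K t x - topShellA₁₃ θ hP K₀ g₀ os ρ n K t x = topCoreA₁₃ θ hP K₀ g₀ os ρ n K t x := by
  have hζ0 : ∀ p g k s Pl Ql RS U V', 0 ≤ θ.ζ p g k s Pl Ql RS U V' :=
    fun p g k s Pl Ql RS U V' => zetaOfRecord_nonneg F N θ.ν θ.τ9.M hP.zetaUnity hP.zetaAbs p g k s Pl Ql RS U V'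
  have hU : LocalBgMeasurable F N θ.ν := localBgMeasurable F N θ.ν
  have hD : (datumOfRecord₁₃CoPH F N θ hP).AvgMeasurable := (isPrintedAveraged_datumOfRecord₁₃CoPH F N θ hP).avgMeasurable
  letI : ∀ Kc, DecidableEq (SiteSeqKey F Kc) := fun _ => Classical.decEq _
  unfold topWeightA₁₃ topShellA₁₃ topCoreA₁₃
  rw [← Finset.sum_sub_distrib]
  refine Finset.sum_congr rfl fun s _ => ?_
  exact topTermAtLevel_sub_topBandAtLevel_eq_lowered F N θ.toStage9Params (datumOfRecord₁₃CoPH F N θ hP) g₀ os (runA₁₃ F K₀ g₀ K) (histA₁₃ θ K₀ g₀ K) hζm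
    hP.zetaAbs (cutGrid_succ_le (K₀ + K) hε hρ0 hρ1 _) t
    (fun k _ s => integrable_chi_mul_dressedSlots_of_ppSelLive θ.toStage9Params E hsel hU hζm hζ0 hP.zetaAbs _ hD g₀ os (histA₁₃_zero θ K₀ g₀ K) t k s)
    (K₀ + K) rfl s

/-- ★★ **RUN B: the same** (`0 ≤ ε_{K₀+K+1}`). [bookkeeping] -/
theorem topWeightB₁₃_sub_topShellB₁₃ (K₀ : ℕ) (θ : Stage13HParams F N) (hP : θ.Provisos₁₃CoPH F N) (g₀ : ℕ → ℝ) (os : List (ULoop F)) (E : B12.RunParams → ℝ)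
    (hsel : θ.ppSel = ppSelLiveOfRecord F N θ.ν θ.τ9 E (wOfRecord₉ F N θ.toStage9Params)) (hζm : ZetaMeasurable F N θ.ζ) {ρ : ℕ → ℝ} (n : ℕ → ℕ) (K : ℕ)
    (hρ0 : 0 ≤ ρ K) (hρ1 : ρ K ≤ 1) (hε : 0 ≤ epsOfRecord θ.ν (histB₁₃ θ K₀ g₀ K) (K₀ + K + 1)) (t : ℝ) (x : Σ K, SiteSeqKey F (K₀ + K)) :
    topWeightB₁₃ θ hP K₀ g₀ os ρ n K t x - topShellB₁₃ θ hP K₀ g₀ os ρ n K t x = topCoreB₁₃ θ hP K₀ g₀ os ρ n K t x := by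
  have hζ0 : ∀ p g k s Pl Ql RS U V', 0 ≤ θ.ζ p g k s Pl Ql RS U V' :=
    fun p g k s Pl Ql RS U V' => zetaOfRecord_nonneg F N θ.ν θ.τ9.M hP.zetaUnity hP.zetaAbs p g k s Pl Ql RS U V'
  have hU : LocalBgMeasurable F N θ.ν := localBgMeasurable F N θ.ν
  have hD : (datumOfRecord₁₃CoPH F N θ hP).AvgMeasurable := (isPrintedAveraged_datumOfRecord₁₃CoPH F N θ hP).avgMeasurable
  letI : ∀ Kc, DecidableEq (SiteSeqKey F Kc) := fun _ => Classical.decEq _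
  unfold topWeightB₁₃ topShellB₁₃ topCoreB₁₃
  rw [← Finset.sum_sub_distrib]
  refine Finset.sum_congr rfl fun s' _ => ?_
  exact topTermAtLevel_sub_topBandAtLevel_eq_lowered F N θ.toStage9Params (datumOfRecord₁₃CoPH F N θ hP) g₀ os (runB₁₃ F K₀ g₀ K) (histB₁₃ θ K₀ g₀ K) hζm
    hP.zetaAbs (cutGrid_succ_le (K₀ + K + 1) hε hρ0 hρ1 _) t
    (fun k _ s => integrable_chi_mul_dressedSlots_of_ppSelLive θ.toStage9Params E hsel hU hζm hζ0 hP.zetaAbs _ hD g₀ os (histB₁₃_zero θ K₀ g₀ K) t k s)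
    (K₀ + K + 1) rfl s'

/-- ★★ **THE CORES OF THE TOP-LETTERED READING**: on the live line, in the meaningful regime (width and threshold sign rows read at the tuple), the reading's
`A K t x − shA K t x` and `B K t x − shB K t x` — the arguments of the K3 skeleton's `KeyedCoreEdgeHolderD4` ∕ `NE7.Core` at `crTop₁₃VAt` — ARE the keyed cores
`topCoreA₁₃ ∕ topCoreB₁₃` (lowered top-lettered terms).  The sandwich N19′ must prove reads THESE. [bookkeeping] -/
theorem crTop₁₃VAt_core_eq (K₀ : ℕ) (jcut : ℕ → ℕ) (ρ : WidthLetter₁₃CoPH N) (n : DepthLetter₁₃CoPH N) (θ : Stage13HParams F N) (hP : θ.Provisos₁₃CoPH F N)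
    (g₀ : ℕ → ℝ) (os : List (ULoop F)) (E : B12.RunParams → ℝ) (hsel : θ.ppSel = ppSelLiveOfRecord F N θ.ν θ.τ9 E (wOfRecord₉ F N θ.toStage9Params))
    (hζm : ZetaMeasurable F N θ.ζ) (K : ℕ) (hρ0 : 0 ≤ ρ F θ hP g₀ os K) (hρ1 : ρ F θ hP g₀ os K ≤ 1) (hεA : 0 ≤ epsOfRecord θ.ν (histA₁₃ θ K₀ g₀ K) (K₀ + K))
    (hεB : 0 ≤ epsOfRecord θ.ν (histB₁₃ θ K₀ g₀ K) (K₀ + K + 1)) (t : ℝ) (x : Σ K, SiteSeqKey F (K₀ + K)) :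
    (crTop₁₃VAt N K₀ jcut ρ n F θ hP g₀ os).A K t x - (crTop₁₃VAt N K₀ jcut ρ n F θ hP g₀ os).shA K t x =
        topCoreA₁₃ θ hP K₀ g₀ os (ρ F θ hP g₀ os) (n F θ hP g₀ os) K t x ∧
      (crTop₁₃VAt N K₀ jcut ρ n F θ hP g₀ os).B K t x - (crTop₁₃VAt N K₀ jcut ρ n F θ hP g₀ os).shB K t x =
        topCoreB₁₃ θ hP K₀ g₀ os (ρ F θ hP g₀ os) (n F θ hP g₀ os) K t x :=
  ⟨topWeightA₁₃_sub_topShellA₁₃ K₀ θ hP g₀ os E hsel hζm _ K hρ0 hρ1 hεA t x, topWeightB₁₃_sub_topShellB₁₃ K₀ θ hP g₀ os E hsel hζm _ K hρ0 hρ1 hεB t x⟩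

end CoreReading

/-! ## §27 The K3 skeleton's `KeyedShellWeight` conjunct AT `crTop₁₃V`, spelled per tuple with its rows (the pin a `PinnedAtLive` naming this reading would use) -/

section SkeletonShape

variable {N : ℕ} [NeZero N]

/-- ★★ **THE `KeyedShellWeight` CONJUNCT OF STUB 2 AT THE TOP-LETTERED READING `crTop₁₃V N jcut ρ n`, PER TUPLE WITH ITS ROWS**: for every family, every Stage-13 tuple with
provisos ON THE LIVE-SELECTOR LINE (the selector pinned at a tuple-read `E`, as the skeleton's `LiveSel` does with `E := EOfRecord₁₃ …`), under (H-ζ), and every `g₀, os` at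
which the width letter stays `≤ 1` and the depth letter has `Σ_K 1∕(n_K+1) < ∞`: `ShellWeightBound` at the reading's own `l₀, T, A, B, shA, shB, Wsh` — R2's
`shellWeightBound_crTop₁₃VAt` at `K₀ = 0`; (M1)-FREE; the guards `ZhUnity ∧ SlotsNondegenerate₁₃` and `Admissible` of the skeleton's binder are not read. [bookkeeping] -/
theorem keyedShellWeight_shape_crTop₁₃V_of_rows (jcut : ℕ → ℕ) (ρ : WidthLetter₁₃CoPH N) (n : DepthLetter₁₃CoPH N)
    (E : (F : T4Family) → Stage13HParams F N → (B12.RunParams → ℝ)) :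
    ∀ (F : T4Family) (θ : Stage13HParams F N) (hP : θ.Provisos₁₃CoPH F N),
      θ.ppSel = ppSelLiveOfRecord F N θ.ν θ.τ9 (E F θ) (wOfRecord₉ F N θ.toStage9Params) → ZetaMeasurable F N θ.ζ →
      ∀ (g₀ : ℕ → ℝ) (os : List (ULoop F)), (∀ K, ρ F θ hP g₀ os K ≤ 1) → Summable (fun K => 1 / ((n F θ hP g₀ os K : ℝ) + 1)) →
        ShellWeightBound (crTop₁₃V N jcut ρ n F θ hP g₀ os).l₀ (crTop₁₃V N jcut ρ n F θ hP g₀ os).T (crTop₁₃V N jcut ρ n F θ hP g₀ os).A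
          (crTop₁₃V N jcut ρ n F θ hP g₀ os).B (crTop₁₃V N jcut ρ n F θ hP g₀ os).shA (crTop₁₃V N jcut ρ n F θ hP g₀ os).shB
          (crTop₁₃V N jcut ρ n F θ hP g₀ os).Wsh :=
  fun F θ hP hsel hζm g₀ os hρ1 hn => shellWeightBound_crTop₁₃VAt 0 jcut ρ n θ hP g₀ os (E F θ) hsel hζm hρ1 hn

end SkeletonShape

end Summit.QuantumFields.YangMills.Theorems.N21ShellSplitOfRecord13CoPH

end
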